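import Summits.BirchSwinnertonDyer.BirchSwinnertonDyer.Theorems.SignedLowerHalvesSmallImageLowerHalfBothSignsRttJunctionShaLocCountCyc
import Summits.BirchSwinnertonDyer.BirchSwinnertonDyer.Theorems.SignedLowerHalvesSmallImageLowerHalfBothSignsRttJunctionShaRhoTwoFinite
import Summits.BirchSwinnertonDyer.BirchSwinnertonDyer.Theorems.SignedLowerHalvesSmallImageLowerHalfBothSignsRttJunctionEulerDict
import Literature.NumberTheory.EllipticCurves.IwasawaTowerTorsionPotGoodFiniteProofs
import Literature.NumberTheory.EllipticCurves.SelmerCorankAssembly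
import Literature.NumberTheory.EllipticCurves.TwoVariableSelmerDual
import Literature.NumberTheory.EllipticCurves.GreenbergSelmerNewform
import HarnessLib

/-!
# Route `SignedLowerHalves`, crux L `SmallImageLowerHalfBothSigns` (stmt-BirchSwinnertonDyer-23599), line `rtt_w3` v30 — stub S3α′ (`stub_junctionShaPT_ns`),
# brick α2-lev (part 6): THE DISPLAYED INPUT AT `vp` FROM THE TREE'S IMAI/SERRE CURRENCIES — «`θ′` non-trivial on `D_{vp} ∩ Gal(K̄/K_∞)`» from the finiteness of the
# local tower torsion `E(K_{vp,∞})[p^∞]` (Imai) and Serre's no-stable-line at `vp`, through the frame's `j : E[p^∞] → Cofree θ`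

INPUTS hand `bsd-inputs-honda-p1` g28 under LEAD `cruxlead-stmt-BirchSwinnertonDyer-23599` g14 (cell `bsd-ssimc`); helper `--supports stmt-BirchSwinnertonDyer-23599`. THEOREMS ONLY.
WHAT. ★★★ `exists_apply_ne_one_of_fixedPoints_finite`: for `E/K`, a `ℤ_p`-extension `κ`, a place `v`, the frame's rank-one `θ` with `θ′·θ₀₀ = 1`, an additive
`j : E[p^∞] → Cofree θ F` equivariant for `Γ_{K_v}` (the frame's `j`, at `v ∣ p`) with `Cofree θ F` non-trivial and `𝒪 · j(E[p^∞]) = ⊤`, IF (Serre) `E[p^∞]` has no `D_v`-stable `p`-divisible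
subgroup with `≤ p` points of order `p` other than `0` (tree currency of `Serre1967.noStableDivisibleLine_of_potentiallySupersingular`) AND (Imai) the points of `E[p^∞]` fixed by `D_v ⊓ ker κ` are
finite (tree currency of `IwasawaTowerTorsion.WeierstrassCurve.localTowerTorsionFiniteAt_of_noStableDivisibleLine`), THEN some `τ ∈ Γ_{K_v}` lies over `K_∞` (`res τ ∈ U_n` for all `n`) with
`θ′(res τ) ≠ 1` — EXACTLY the hypothesis of part 5's `exists_bound_semilocCoh_two_of_apply_ne_one'`. Proof: if `θ′ = 1` on `H = D_v ⊓ ker κ` then `θ = 1` there, `H` acts trivially on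
`Cofree θ F`, so `j(h t − t) = 0`; the subgroup generated by the `h t − t` is `D_v`-stable (`H ⊴ D_v`), `p`-divisible (`E[p^∞]` is), inside `ker j ≠ ⊤`, hence has `≤ p` points of order `p`
(`ncard_pTorsion_le_of_divisible_of_ne_top`), hence is `0` by Serre: `H` fixes `E[p^∞]`, which is infinite — against Imai.
HONEST FRAMING: the two displayed inputs (Serre no-stable-line at `vp` for `E = W ⊗ K`, and the Imai finiteness — the latter follows from the former in the tree once `μ_p ⊄ K_{vp}`) are NOT
proved here; nothing about S3α′, E2, crux L or BSD is proved; all remain OPEN and are proved for NO curve.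
References: [Imai1975] Theorem (p. 12); [Serre1967GroupesPDivisibles] §5 Prop. 8; [GreenbergLNM1716] §3 Lemma 3.3 (p. 87); [SilvermanAEC2009] Cor. III.6.4.
-/

set_option autoImplicit false
set_option linter.dupNamespace false -- D-0017: single-problem summit, the namespace repeats the problem name by design
noncomputable section

open scoped Classical
open NumberField IsDedekindDomain Field Function

namespace Summit.BirchSwinnertonDyer.BirchSwinnertonDyer.Theorems.SmallImageRttJunctionSha

open Literature.NumberTheory.EllipticCurves Literature.NumberTheory.GaloisRepresentations
  Literature.NumberTheory.EllipticCurves.IwasawaTowerTorsion.LocalTowerTorsionLine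
  Literature.NumberTheory.ComplexMultiplication.EllipticUnits.JohnsonLeungKings2011
  WeierstrassCurve

section Imai

variable {K : Type} [Field K] [NumberField K] {p : ℕ} [hp : Fact p.Prime] (S : Set (PadicAlgCl p))
  (E : WeierstrassCurve K) [E.IsElliptic] (κ : ZpExtension K p) (v : HeightOneSpectrum (𝓞 K))
  (θ : FramedGaloisRep K (padicCoeffIntegers S) 1) (θ' : absoluteGaloisGroup K →ₜ* (padicCoeffIntegers S)ˣ)

/-- ★★★ **`θ′` IS NON-TRIVIAL ON `D_v ∩ Gal(K̄/K_∞)` whenever the local tower torsion `E(K_{v,∞})[p^∞]` is finite and `E[p^∞]` has no `D_v`-stable line** (through the frame's `j`).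
[cite: Imai1975, Theorem (p. 12)] [cite: Serre1967GroupesPDivisibles, §5 Prop. 8] [cite: GreenbergLNM1716, §3 Lemma 3.3 (p. 87)] -/
theorem exists_apply_ne_one_of_fixedPoints_finite
    (hθ'θ : ∀ g : absoluteGaloisGroup K, ((θ' g : (padicCoeffIntegers S)ˣ) : padicCoeffIntegers S) *
      ((θ g : GL (Fin 1) (padicCoeffIntegers S)) : Matrix (Fin 1) (Fin 1) (padicCoeffIntegers S)) 0 0 = 1)
    [Nontrivial (GreenbergSelmer.Cofree θ (padicCoeffField S))]
    (j : E.geomPrimaryTorsion p →+ GreenbergSelmer.Cofree θ (padicCoeffField S))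
    (hj : ∀ (δ : absoluteGaloisGroup (v.adicCompletion K)) (t : E.geomPrimaryTorsion p),
      j (resGalOfEmb (closureEmb (K := K) (v.adicCompletion K)) δ • t) = resGalOfEmb (closureEmb (K := K) (v.adicCompletion K)) δ • j t)
    (hjspan : Submodule.span (padicCoeffIntegers S) (Set.range j) = ⊤)
    (hline : ∀ N : AddSubgroup (E.geomPrimaryTorsion p),
      (∀ d ∈ GreenbergSelmer.decomp v, ∀ c ∈ N, d • c ∈ N) → (∀ c ∈ N, ∃ c' ∈ N, p • c' = c) →
        Set.ncard {c : E.geomPrimaryTorsion p | c ∈ N ∧ p • c = 0} ≤ p → N = ⊥)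
    (hFin : (FixedPoints.addSubgroup ↥(GreenbergSelmer.decomp v ⊓ κ.kerSubgroup) (E.geomPrimaryTorsion p) : Set (E.geomPrimaryTorsion p)).Finite) :
    ∃ τ : absoluteGaloisGroup (v.adicCompletion K),
      (∀ n, resGalOfEmb (closureEmb (K := K) (v.adicCompletion K)) τ ∈ κ.layerSubgroup n) ∧
        θ' (resGalOfEmb (closureEmb (K := K) (v.adicCompletion K)) τ) ≠ 1 := by
  by_contra hno
  push Not at hno
  set H : Subgroup (absoluteGaloisGroup K) := GreenbergSelmer.decomp v ⊓ κ.kerSubgroup with hH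
  -- (1) `θ = 1` on `H`, so `H` acts trivially on `Cofree θ F` and `j (h t - t) = 0`
  have hθ1 : ∀ h ∈ H, θ h = 1 := by
    intro h hh
    obtain ⟨hD, hk⟩ := Subgroup.mem_inf.mp hh
    obtain ⟨τ, rfl⟩ := MonoidHom.mem_range.mp hD
    have hτU : ∀ n, resGalOfEmb (closureEmb (K := K) (v.adicCompletion K)) τ ∈ κ.layerSubgroup n :=
      fun n ↦ κ.kerSubgroup_le_layerSubgroup n hk
    exact (SmallImageRttJunctionEuler.apply_eq_one_iff_of_mul_eq_one θ θ' hθ'θ _).mp (hno τ hτU)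
  have hcof : ∀ h ∈ H, ∀ a : GreenbergSelmer.Cofree θ (padicCoeffField S), h • a = a := by
    intro h hh a
    obtain ⟨x, rfl⟩ := GreenbergSelmer.cofreeMk_surjective (padicCoeffField S) θ a
    rw [GreenbergSelmer.smul_def, GreenbergSelmer.cofreeRepresentation_cofreeMk, GreenbergSelmer.fracRepresentation_apply_apply, hθ1 h hh,
      Units.val_one, Matrix.map_one _ (map_zero _) (map_one _), Matrix.one_mulVec]
  have hker : ∀ h ∈ H, ∀ t : E.geomPrimaryTorsion p, j (h • t - t) = 0 := by
    intro h hh t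
    obtain ⟨hD, -⟩ := Subgroup.mem_inf.mp hh
    obtain ⟨τ, hτ⟩ := MonoidHom.mem_range.mp hD
    have h1 : j (h • t) = h • j t := by rw [← hτ]; exact hj τ t
    rw [map_sub, sub_eq_zero, h1, hcof h hh]
  -- (2) the subgroup generated by the `h t - t`
  set N : AddSubgroup (E.geomPrimaryTorsion p) := AddSubgroup.closure {x : E.geomPrimaryTorsion p | ∃ h ∈ H, ∃ t : E.geomPrimaryTorsion p, x = h • t - t} with hN
  have hHconj : ∀ d ∈ GreenbergSelmer.decomp v, ∀ h ∈ H, d * h * d⁻¹ ∈ H := by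
    intro d hd h hh
    obtain ⟨hD, hk⟩ := Subgroup.mem_inf.mp hh
    refine Subgroup.mem_inf.mpr ⟨(GreenbergSelmer.decomp v).mul_mem ((GreenbergSelmer.decomp v).mul_mem hd hD) ((GreenbergSelmer.decomp v).inv_mem hd), ?_⟩
    rw [ZpExtension.mem_kerSubgroup] at hk ⊢
    rw [map_mul, map_mul, map_inv, hk, mul_one, mul_inv_cancel]
  have hNstab : ∀ d ∈ GreenbergSelmer.decomp v, ∀ c ∈ N, d • c ∈ N := by
    intro d hd c hc
    refine AddSubgroup.closure_induction (p := fun c _ ↦ d • c ∈ N) ?_ ?_ ?_ ?_ hc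
    · rintro x ⟨h, hh, t, rfl⟩
      refine AddSubgroup.subset_closure ⟨d * h * d⁻¹, hHconj d hd h hh, d • t, ?_⟩
      rw [smul_sub, mul_smul, mul_smul, inv_smul_smul]
    · rw [smul_zero]; exact N.zero_mem
    · intro x y _ _ hx hy
      rw [smul_add]; exact N.add_mem hx hy
    · intro x _ hx
      rw [smul_neg]; exact N.neg_mem hx
  have hNdiv : ∀ c ∈ N, ∃ c' ∈ N, p • c' = c := by
    intro c hc
    refine AddSubgroup.closure_induction (p := fun c _ ↦ ∃ c' ∈ N, p • c' = c) ?_ ?_ ?_ ?_ hc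
    · rintro x ⟨h, hh, t, rfl⟩
      obtain ⟨t', ht'⟩ := exists_nsmul_eq_geomPrimaryTorsion E p E.zsmul_geomPoints_surjective_holds t
      exact ⟨h • t' - t', AddSubgroup.subset_closure ⟨h, hh, t', rfl⟩, by rw [smul_sub, smul_comm, ht']⟩
    · exact ⟨0, N.zero_mem, smul_zero _⟩
    · rintro x y _ _ ⟨x', hx', rfl⟩ ⟨y', hy', rfl⟩
      exact ⟨x' + y', N.add_mem hx' hy', smul_add _ _ _⟩
    · rintro x _ ⟨x', hx', rfl⟩
      exact ⟨-x', N.neg_mem hx', smul_neg _ _⟩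
  have hNker : ∀ c ∈ N, j c = 0 := by
    intro c hc
    refine AddSubgroup.closure_induction (p := fun c _ ↦ j c = 0) ?_ (map_zero j) ?_ ?_ hc
    · rintro x ⟨h, hh, t, rfl⟩; exact hker h hh t
    · intro x y _ _ hx hy; rw [map_add, hx, hy, add_zero]
    · intro x _ hx; rw [map_neg, hx, neg_zero]
  -- (3) `N ≠ ⊤` since `j ≠ 0`
  have hNtop : N ≠ ⊤ := by
    intro htop
    have hj0 : ∀ t : E.geomPrimaryTorsion p, j t = 0 := fun t ↦ hNker t (by rw [htop]; exact AddSubgroup.mem_top t)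
    have hrange : Set.range j = {0} := by
      ext y
      simp only [Set.mem_range, Set.mem_singleton_iff]
      exact ⟨fun ⟨t, ht⟩ ↦ ht ▸ hj0 t, fun hy ↦ ⟨0, by rw [hy, map_zero]⟩⟩
    rw [hrange, Submodule.span_singleton_eq_bot.mpr rfl] at hjspan
    exact bot_ne_top hjspan
  -- (4) Serre: `N = ⊥`, so `H` fixes `E[p^∞]`
  have hcount := ncard_pTorsion_le_of_divisible_of_ne_top (p := p) N (fun m ↦ exists_pow_smul_geomPrimaryTorsion_eq_zero E p m)
    (ncard_geomPrimaryTorsion_pTorsion_eq_sq E) hNdiv hNtop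
  have hNbot : N = ⊥ := hline N hNstab hNdiv hcount
  have hfix : ∀ h ∈ H, ∀ t : E.geomPrimaryTorsion p, h • t = t := by
    intro h hh t
    have hmem : h • t - t ∈ N := AddSubgroup.subset_closure ⟨h, hh, t, rfl⟩
    rw [hNbot, AddSubgroup.mem_bot, sub_eq_zero] at hmem
    exact hmem
  -- (5) hence `E[p^∞]` is finite — impossible, it is `p`-divisible with `p²` points of order `p`
  have huniv : (FixedPoints.addSubgroup ↥H (E.geomPrimaryTorsion p) : Set (E.geomPrimaryTorsion p)) = Set.univ := by
    ext t
    simp only [SetLike.mem_coe, Set.mem_univ, iff_true]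
    rw [FixedPoints.mem_addSubgroup]
    rintro ⟨h, hh⟩
    rw [Subgroup.mk_smul]
    exact hfix h hh t
  have hMfin : Finite (E.geomPrimaryTorsion p) := by
    have h := hFin
    rw [huniv] at h
    exact Set.finite_univ_iff.mp h
  have hsurj : Function.Surjective fun t : E.geomPrimaryTorsion p ↦ p • t := fun t ↦ exists_nsmul_eq_geomPrimaryTorsion E p E.zsmul_geomPoints_surjective_holds t
  have hinj : Function.Injective fun t : E.geomPrimaryTorsion p ↦ p • t := Finite.injective_iff_surjective.mpr hsurj
  have hsub : {m : E.geomPrimaryTorsion p | p • m = 0} ⊆ {0} := fun m hm ↦ by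
    simp only [Set.mem_setOf_eq] at hm
    exact hinj (by simp only [hm, smul_zero])
  have hle : Set.ncard {m : E.geomPrimaryTorsion p | p • m = 0} ≤ 1 := (Set.ncard_le_ncard hsub (Set.finite_singleton 0)).trans (by rw [Set.ncard_singleton])
  rw [ncard_geomPrimaryTorsion_pTorsion_eq_sq E] at hle
  exact absurd hle (not_le.mpr (Nat.one_lt_pow two_ne_zero hp.out.one_lt))

end Imai

/-! ## S3α′ minus `π`, with the `vp`-input in the tree's Imai/Serre currencies -/

section Frame

variable {p : ℕ} [hp : Fact p.Prime] (hp2 : p ≠ 2) {κ : ZpExtension ℚ p} {K : Type} [Field K] [NumberField K] (hK2 : Module.finrank ℚ K = 2)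

/-- ★★★ **S3α′ MINUS `π`, `vp`-INPUT IN TREE CURRENCY**: as `exists_rhoTwo_finite_of_frameSupp` (p815886), with the displayed hypothesis at the places above `p` replaced by: non-split in the tower
(tree `isNonsplitIn_restrictOfFinrankEqTwo` at the inert `vp`), Serre's no-stable-line for `E[p^∞]` at `w` and the finiteness of the local tower torsion `E(K_{w,∞})[p^∞]` (Imai) — read through the
frame's `θ`, `θ′·θ₀₀ = 1` and the `Γ_{K_w}`-equivariant `j : E[p^∞] → Cofree θ` with `𝒪 · range j = ⊤`. [cite: Imai1975, Theorem (p. 12)] [cite: Serre1967GroupesPDivisibles, §5 Prop. 8]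
[cite: NeukirchSchmidtWingberg2008, (8.6.3), (8.6.10)] [cite: PerrinRiou1994Invent, §1.3] -/
theorem exists_rhoTwo_finite_of_frameSupp_of_localTowerTorsionFinite (S : Set (PadicAlgCl p)) [FiniteDimensional ℚ_[p] (padicCoeffField S)]
    (hκ : κ.IsCyclotomic) {γ : absoluteGaloisGroup ℚ} (hγ : κ.IsTopGenerator γ) (hcv : IsCyclotomicVariable p γ)
    (θ : FramedGaloisRep K (padicCoeffIntegers S) 1) (θ' : absoluteGaloisGroup K →ₜ* (padicCoeffIntegers S)ˣ)
    (hθ'θ : ∀ g : absoluteGaloisGroup K, ((θ' g : (padicCoeffIntegers S)ˣ) : padicCoeffIntegers S) *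
      ((θ g : GL (Fin 1) (padicCoeffIntegers S)) : Matrix (Fin 1) (Fin 1) (padicCoeffIntegers S)) 0 0 = 1)
    [Nontrivial (GreenbergSelmer.Cofree θ (padicCoeffField S))]
    (E : WeierstrassCurve K) [E.IsElliptic] (j : E.geomPrimaryTorsion p →+ GreenbergSelmer.Cofree θ (padicCoeffField S))
    (hj : ∀ v : HeightOneSpectrum (𝓞 K), ((p : ℕ) : 𝓞 K) ∈ v.asIdeal →
      ∀ (δ : absoluteGaloisGroup (v.adicCompletion K)) (t : E.geomPrimaryTorsion p),
        j (resGalOfEmb (closureEmb (K := K) (v.adicCompletion K)) δ • t) = resGalOfEmb (closureEmb (K := K) (v.adicCompletion K)) δ • j t)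
    (hjspan : Submodule.span (padicCoeffIntegers S) (Set.range j) = ⊤)
    {𝔣 : Ideal (𝓞 K)} (h𝔣 : 𝔣 ≠ ⊥)
    (hR : ∀ w ∈ suppPF p 𝔣, ((p : ℕ) : 𝓞 K) ∉ w.asIdeal → ∃ 𝔓 ∈ w.primesAbove, ∃ τ ∈ 𝔓.inertia (absoluteGaloisGroup K), θ' τ ≠ 1)
    {m₀ : ℕ} (hm₀ : m₀ ≠ 0)
    (hθm : ∀ w : HeightOneSpectrum (𝓞 K), ((p : ℕ) : 𝓞 K) ∉ w.asIdeal → ∀ 𝔓 ∈ w.primesAbove, ∀ τ ∈ 𝔓.inertia (absoluteGaloisGroup K), θ' τ ^ m₀ = 1)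
    (hvp : ∀ w ∈ suppPF p 𝔣, ((p : ℕ) : 𝓞 K) ∈ w.asIdeal →
      AcSigned.IsNonsplitIn (κ.restrictOfFinrankEqTwo hp2 K hK2) w ∧
      (∀ N : AddSubgroup (E.geomPrimaryTorsion p),
        (∀ d ∈ GreenbergSelmer.decomp w, ∀ c ∈ N, d • c ∈ N) → (∀ c ∈ N, ∃ c' ∈ N, p • c' = c) →
          Set.ncard {c : E.geomPrimaryTorsion p | c ∈ N ∧ p • c = 0} ≤ p → N = ⊥) ∧
      (FixedPoints.addSubgroup ↥(GreenbergSelmer.decomp w ⊓ (κ.restrictOfFinrankEqTwo hp2 K hK2).kerSubgroup) (E.geomPrimaryTorsion p) :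
        Set (E.geomPrimaryTorsion p)).Finite)
    (hNP : ∀ n, ramificationSubgroup K (suppPF p 𝔣) ≤ (κ.restrictOfFinrankEqTwo hp2 K hK2).layerSubgroup n)
    {γK : absoluteGaloisGroup K}
    (I : SmallImageRttD2J1.CycIwasawaCohomologyDataO S (κ.restrictOfFinrankEqTwo hp2 K hK2) γK θ' (suppPF p 𝔣) 2) :
    letI := I.moduleIwasawa
    ∃ (Loc : Type) (_ : AddCommGroup Loc) (_ : Module (IwasawaAlgebra p) Loc) (_ : Finite Loc) (ρ : I.H →ₗ[IwasawaAlgebra p] Loc),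
      ∀ b : I.H, ρ b = 0 ↔ ∀ w ∈ suppPF p 𝔣, ∀ (n k : ℕ) (δ : absoluteGaloisGroup K),
        ContinuousCohomology.map (SmallImageRttD2Seq.locLayerHom (κ.restrictOfFinrankEqTwo hp2 K hK2) (suppPF p 𝔣) w n)
          (SmallImageRttD2Seq.locLayerMod S (κ.restrictOfFinrankEqTwo hp2 K hK2) θ' (suppPF p 𝔣) w n k) 2
          (SmallImageRttD2J1.cycLayerConjO S (κ.restrictOfFinrankEqTwo hp2 K hK2) θ' (suppPF p 𝔣) n k 2 δ (I.proj n k b)) = 0 := by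
  obtain ⟨Loc, i1, i2, ρ, hker, hfin⟩ := exists_rhoTwo_loc hNP (suppPF p 𝔣) I
  refine ⟨Loc, i1, i2, hfin (SmallImageRttD2Seq.finite_suppPF_of_ne_bot h𝔣) (fun w hw ↦ ?_), ρ, hker⟩
  by_cases hwp : ((p : ℕ) : 𝓞 K) ∈ w.asIdeal
  · obtain ⟨hv, hline, hFin⟩ := hvp w hw hwp
    obtain ⟨τ, hτU, hτθ⟩ := exists_apply_ne_one_of_fixedPoints_finite S E (κ.restrictOfFinrankEqTwo hp2 K hK2) w θ θ' hθ'θ j (hj w hwp) hjspan hline hFin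
    exact exists_bound_semilocCoh_two_of_apply_ne_one' S (κ.restrictOfFinrankEqTwo hp2 K hK2) θ' (suppPF p 𝔣) w hv hτU hτθ
  · exact exists_bound_semilocCoh_two_of_frameSupp hp2 hK2 S hκ hγ hcv θ' 𝔣 hR hm₀ hθm hw hwp

end Frame

end Summit.BirchSwinnertonDyer.BirchSwinnertonDyer.Theorems.SmallImageRttJunctionSha

end
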